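import Mathlib
import HarnessLib.Audit
import Summits.PneNP.PneNP.Theorems.PstarChordBridgeTerminalData
import Summits.PneNP.PneNP.Theorems.PstarNorUnitDirection
import Summits.PneNP.PneNP.Theorems.PstarGapTwoAssembly

/-!
# The R-chain on raw terminal data: five outputs, and the conditional two-query bound (ROUND-24, memo §9; GAPTWO-PLAN S4)

FRONTIER range-avoidance ladder, rung F-N3, ROUND 24 (cell `pnp-ideate`, planner memo `r24/CORE-BOUND-NOTES.md` §9 R0–R9 ("PROOF ARCHITECTURE
FOR CoreBound … best attacked through the strong form `CoreBoundAt`"); restricted-model proof complexity — nothing here bears on `P` versus `NP`).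

END OF THE CHAIN.  `PstarNorUnitDirection.card_le_five` (prover-1; with `PstarChordBridgeKill.regime_cases` and
`PstarChordBridgeCornerUnit.card_eq_three_of_corner`) bounds every terminal core by five AT THE LEVEL OF BRIDGE DATA; `PstarChordBridgeTerminalData`
builds that bridge data from raw terminal data.  This file states the composite where the rung lives:

* `card_le_five_of_terminal` — RAW FORM: pure typed `(r,3/2)`-expanding instance with simple overlaps; a non-empty XOR-closed core `J₀` with
  `#J₀ < r`; two G-constraints `w₁, w₂` with monomials off `J₀` and `#(J₀ ∪ G₁ ∪ G₂) ≤ r`; (T3) `J₀ ∧ w₁ ∧ w₂` unsolvable, (M0) solvable after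
  deleting any output of `J₀`; a maximal leaf-peelable `F ⊆ J₀` whose co-edges are chords (ASSUMPTION A, memo O1) and whose co-edge privates no
  monomial touches (PRIVATES UNREAD ⊇ no CROSS, memo O2).  Then `#J₀ ≤ 5`;
* `card_le_five_of_terminal_W` — the same with the constraints as a finset `𝒲` of at most two G-constraints whose monomials lie in `J ∖ J₀`
  for an ambient output set `J ⊇ J₀` with `#J ≤ r` (the vocabulary of `PstarGapTwoAssembly.CoreBoundAt`);
* `coreBoundAt_of_chain` — **`CoreBoundAt I y J 5` for every output set `J` (`#J < r`) all of whose non-empty XOR-closed subsets satisfy the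
  two standing assumptions**;
* `card_le_of_chain` — hence, by `PstarGapTwoAssembly.card_le_of_coreBoundAt`, **the two-query bound `#J ≤ 8Δ² + 5(4Δ + 1)` for every
  minimal infeasible `J` (`#J < r`, at most two parity constraints, variable degree `≤ Δ`) satisfying them** — the `h = 2` rung `GapTwo`
  conditionally on O1/O2, with an absolute core constant.

What is NOT claimed: Assumption A and privates-unread are genuine restrictions (memo §7 G1/G3, §10.1: centre cycles; gate readers `(p_e, τ)`
on a chord private — the gate family has cores of size `3` by the kit censuses but is outside this theorem).
-/

set_option linter.dupNamespace false -- `Summit.PneNP.PneNP.…`: summit = sub-problem name (D-0017 single-conjunct layout)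

open Finset Module Literature.Computability.Complexity
open Summit.PneNP.PneNP.Theorems.PstarTyped (Typed)
open Summit.PneNP.PneNP.Theorems.PstarSALevel (varSet bdry BoundaryExpanding SimpleOverlap)
open Summit.PneNP.PneNP.Theorems.PstarGapLemma (MinInfeasible MaxDegree)
open Summit.PneNP.PneNP.Theorems.PstarGapOneAll (gval)
open Summit.PneNP.PneNP.Theorems.PstarCoreBound (XorClosed)
open Summit.PneNP.PneNP.Theorems.PstarChordRepair (IsChord)
open Summit.PneNP.PneNP.Theorems.PstarGapTwoAssembly (CoreBoundAt card_le_of_coreBoundAt)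
open Summit.PneNP.PneNP.Theorems.PstarChordBridgeTools
open Summit.PneNP.PneNP.Theorems.PstarChordBridge
open Summit.PneNP.PneNP.Theorems.PstarChordBridgeCotree (Peelable)
open Summit.PneNP.PneNP.Theorems.PstarChordBridgeTerminal (Represents exists_pair sat_pair_iff)
open Summit.PneNP.PneNP.Theorems.PstarChordBridgeTerminalData (bridge_of_terminal)
open Summit.PneNP.PneNP.Theorems.PstarNorUnitDirection (card_le_five)

namespace Summit.PneNP.PneNP.Theorems.PstarChordBridgeFive

variable {n m : ℕ}

/-- **Every terminal core has at most five outputs — raw form, two constraints `w₁, w₂`.**  See the module docstring. -/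
theorem card_le_five_of_terminal (I : LocalMap 4 n m) (hI : I.IsPure xorAndPred) (hT : Typed I) (hS : SimpleOverlap I) {r : ℕ}
    (hB : BoundaryExpanding r I) (y : Fin m → Bool) {J₀ : Finset (Fin m)} (hne : J₀.Nonempty) (hX : XorClosed I J₀) (hJr : J₀.card < r)
    (w₁ w₂ : Finset (Fin n) × Finset (Fin m) × Bool) (hG₁ : Disjoint J₀ w₁.2.1) (hG₂ : Disjoint J₀ w₂.2.1)
    (hr : (J₀ ∪ w₁.2.1 ∪ w₂.2.1).card ≤ r)
    (hT3 : ¬ ∃ z : Fin n → Bool, (∀ j ∈ J₀, I.eval z j = y j) ∧ gval I w₁.1 w₁.2.1 z = w₁.2.2 ∧ gval I w₂.1 w₂.2.1 z = w₂.2.2)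
    (hM0 : ∀ f ∈ J₀, ∃ z : Fin n → Bool, (∀ j ∈ J₀.erase f, I.eval z j = y j) ∧ gval I w₁.1 w₁.2.1 z = w₁.2.2 ∧ gval I w₂.1 w₂.2.1 z = w₂.2.2)
    {F : Finset (Fin m)} (hF : F ⊆ J₀) (hP : Peelable I F) (hmax : ∀ F', F ⊆ F' → F' ⊆ J₀ → Peelable I F' → F' = F)
    (hchord : ∀ e ∈ J₀ \ F, IsChord I J₀ e)
    (hun : ∀ g ∈ w₁.2.1 ∪ w₂.2.1, ∀ v ∈ privs I (J₀ \ F), I.vars g 2 ≠ v ∧ I.vars g 3 ≠ v) : J₀.card ≤ 5 := by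
  obtain ⟨B, -, hJ, -, hC, hW, hL, hPe, hD₁, hD₂, hNne, hunB, -, hT3B, hM0B⟩ :=
    bridge_of_terminal I hI hT hS hB y hne hX hJr.le w₁ w₂ hG₁ hG₂ hT3 hM0 hF hP hmax hchord hun
  have hJr' : B.J₀.card < r := by rw [hJ]; exact hJr
  have hr' : (B.J₀ ∪ B.G₁ ∪ B.G₂).card ≤ r := by rw [hJ, hC.2.1, hC.2.2.2.2.1]; exact hr
  have hX' : XorClosed I B.J₀ := by rw [hJ]; exact hX
  rw [← hJ]
  exact card_le_five I hI hT hS hB hW hJr' hr' hX' hPe hD₁ hD₂ hNne hL hunB hT3B hM0B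

/-- **Every terminal core has at most five outputs — finset-of-constraints form** (`𝒲` with `#𝒲 ≤ 2`, monomials in `J ∖ J₀`, `J₀ ⊆ J`,
`#J ≤ r`, `#J₀ < r`). -/
theorem card_le_five_of_terminal_W (I : LocalMap 4 n m) (hI : I.IsPure xorAndPred) (hT : Typed I) (hS : SimpleOverlap I) {r : ℕ}
    (hB : BoundaryExpanding r I) (y : Fin m → Bool) {J J₀ : Finset (Fin m)} (hJ₀J : J₀ ⊆ J) (hJr : J.card ≤ r) (hJ₀r : J₀.card < r)
    (hne : J₀.Nonempty) (hX : XorClosed I J₀) (𝒲 : Finset (Finset (Fin n) × Finset (Fin m) × Bool)) (h𝒲 : 𝒲.card ≤ 2)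
    (hmono : ∀ w ∈ 𝒲, w.2.1 ⊆ J \ J₀)
    (hT3 : ¬ ∃ z : Fin n → Bool, (∀ j ∈ J₀, I.eval z j = y j) ∧ ∀ w ∈ 𝒲, gval I w.1 w.2.1 z = w.2.2)
    (hM0 : ∀ f ∈ J₀, ∃ z : Fin n → Bool, (∀ j ∈ J₀.erase f, I.eval z j = y j) ∧ ∀ w ∈ 𝒲, gval I w.1 w.2.1 z = w.2.2)
    {F : Finset (Fin m)} (hF : F ⊆ J₀) (hP : Peelable I F) (hmax : ∀ F', F ⊆ F' → F' ⊆ J₀ → Peelable I F' → F' = F)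
    (hchord : ∀ e ∈ J₀ \ F, IsChord I J₀ e)
    (hun : ∀ w ∈ 𝒲, ∀ g ∈ w.2.1, ∀ v ∈ privs I (J₀ \ F), I.vars g 2 ≠ v ∧ I.vars g 3 ≠ v) : J₀.card ≤ 5 := by
  classical
  obtain ⟨w₁, w₂, hrep⟩ := exists_pair 𝒲 h𝒲
  -- monomials of the representatives lie in `J ∖ J₀`
  have hsub : ∀ w, (w ∈ 𝒲 ∨ w = ((∅ : Finset (Fin n)), (∅ : Finset (Fin m)), false)) → w.2.1 ⊆ J \ J₀ := by
    rintro w (hw | rfl)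
    · exact hmono w hw
    · exact fun g hg => absurd hg (notMem_empty g)
  have h₁ := hsub w₁ hrep.2.1
  have h₂ := hsub w₂ hrep.2.2
  have hdisj : ∀ w : Finset (Fin n) × Finset (Fin m) × Bool, w.2.1 ⊆ J \ J₀ → Disjoint J₀ w.2.1 :=
    fun w hw => disjoint_left.2 fun j hj hj' => (mem_sdiff.1 (hw hj')).2 hj
  have hr : (J₀ ∪ w₁.2.1 ∪ w₂.2.1).card ≤ r :=
    (card_le_card (union_subset (union_subset hJ₀J (h₁.trans sdiff_subset)) (h₂.trans sdiff_subset))).trans hJr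
  have hunw : ∀ g ∈ w₁.2.1 ∪ w₂.2.1, ∀ v ∈ privs I (J₀ \ F), I.vars g 2 ≠ v ∧ I.vars g 3 ≠ v := by
    intro g hg
    rcases mem_union.1 hg with hg | hg
    · rcases hrep.2.1 with hw | hw
      · exact hun w₁ hw g hg
      · rw [hw] at hg; exact absurd hg (notMem_empty g)
    · rcases hrep.2.2 with hw | hw
      · exact hun w₂ hw g hg
      · rw [hw] at hg; exact absurd hg (notMem_empty g)
  refine card_le_five_of_terminal I hI hT hS hB y hne hX hJ₀r w₁ w₂ (hdisj w₁ h₁) (hdisj w₂ h₂) hr ?_ ?_ hF hP hmax hchord hunw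
  · rintro ⟨z, hz, hz₁, hz₂⟩
    exact hT3 ⟨z, hz, (sat_pair_iff I hrep z).2 ⟨hz₁, hz₂⟩⟩
  · intro f hf
    obtain ⟨z, hz, hzW⟩ := hM0 f hf
    obtain ⟨hz₁, hz₂⟩ := (sat_pair_iff I hrep z).1 hzW
    exact ⟨z, hz, hz₁, hz₂⟩

/-- **The strong-form core bound `CoreBoundAt I y J 5`, conditionally on the standing assumptions.**  Pure typed `(r,3/2)`-expanding instance
with simple overlaps, an output set `J` with `#J < r`, and for every non-empty XOR-closed `J₀ ⊆ J` a maximal leaf-peelable `F ⊆ J₀` whose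
co-edges are chords of `J₀` and whose co-edge privates are touched by no output of `J ∖ J₀`. -/
theorem coreBoundAt_of_chain (I : LocalMap 4 n m) (hI : I.IsPure xorAndPred) (hT : Typed I) (hS : SimpleOverlap I) {r : ℕ}
    (hB : BoundaryExpanding r I) (y : Fin m → Bool) {J : Finset (Fin m)} (hJr : J.card < r)
    (hchain : ∀ J₀ ⊆ J, J₀.Nonempty → XorClosed I J₀ → ∃ F ⊆ J₀, Peelable I F ∧ (∀ F', F ⊆ F' → F' ⊆ J₀ → Peelable I F' → F' = F) ∧
      (∀ e ∈ J₀ \ F, IsChord I J₀ e) ∧ ∀ g ∈ J \ J₀, ∀ v ∈ privs I (J₀ \ F), I.vars g 2 ≠ v ∧ I.vars g 3 ≠ v) :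
    CoreBoundAt I y J 5 := by
  intro J₀ 𝒲 hsub hne _ hcard hmono _ hX _ hT3 hM0 _
  obtain ⟨F, hF, hP, hmax, hchord, hun⟩ := hchain J₀ hsub hne hX
  exact card_le_five_of_terminal_W I hI hT hS hB y hsub hJr.le (lt_of_le_of_lt (card_le_card hsub) hJr) hne hX 𝒲 hcard hmono hT3 hM0
    hF hP hmax hchord fun w hw g hg => hun g (hmono w hw hg)

/-- **The conditional two-query bound.**  On a pure typed `(r,3/2)`-expanding instance with simple overlaps and variable degree `≤ Δ`, every
minimal infeasible output set `J` under at most two parity constraints, with `#J < r` and the standing assumptions on its XOR-closed subsets,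
has `#J ≤ 8Δ² + 5(4Δ + 1)`. -/
theorem card_le_of_chain {Δ r : ℕ} (I : LocalMap 4 n m) (hI : I.IsPure xorAndPred) (hT : Typed I) (hS : SimpleOverlap I)
    (hB : BoundaryExpanding r I) (hD : MaxDegree Δ I) (y : Fin m → Bool) (W : Finset (Finset (Fin n) × Bool)) (J : Finset (Fin m))
    (hW : W.card ≤ 2) (hJr : J.card < r) (hmin : MinInfeasible I y W J)
    (hchain : ∀ J₀ ⊆ J, J₀.Nonempty → XorClosed I J₀ → ∃ F ⊆ J₀, Peelable I F ∧ (∀ F', F ⊆ F' → F' ⊆ J₀ → Peelable I F' → F' = F) ∧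
      (∀ e ∈ J₀ \ F, IsChord I J₀ e) ∧ ∀ g ∈ J \ J₀, ∀ v ∈ privs I (J₀ \ F), I.vars g 2 ≠ v ∧ I.vars g 3 ≠ v) :
    J.card ≤ 8 * Δ ^ 2 + (4 * Δ + 1) * 5 :=
  card_le_of_coreBoundAt I hI hT hS hB hD y W J hW hJr.le hmin (coreBoundAt_of_chain I hI hT hS hB y hJr hchain)

end Summit.PneNP.PneNP.Theorems.PstarChordBridgeFive
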